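import Summits.CriticalPhenomena.PercolationContinuityZ3.Theorems.PercNearOneGluingNoHeavyLowerTailKNGoodGCThreeMultiForced
import HarnessLib

/-!
# GC₃ for ANY NUMBER of pendant-star children — the m-star gluing inequality (`NoHeavyLowerTail` cell, stmt-CriticalPhenomena-4575;
# prover `prim-hp-2`, gen 14; memo MEMO-gen14 §7, THEOREM A)

Support file (`--supports stmt-CriticalPhenomena-4575`).  No definitions, no named facts, no sorries.

* `KNGoodGC3Multi.agood_forced_multi_sorted` — with `W_B` the star-forced weight function of an observer `o` whose children `B` are pendant stars
  into `A = {a₁,a₂,a₃}` (relays labelled by reliability in the core `G ∖ o ∖ B`), and `j ∈ A` satisfying the single row `μ_{G∖o}(j b) ≤ μ_{G∖o}(a₁ b)`: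
  `μ_{W_B}(j b) ≤ μ_{W_B}(o b) + Σ_W μ_{W_B}(C(o) = W)·min_a μ_{W_B}(a b off W)`.
  Proof = memo §7: `forcedMerge_exists` (merged one-layer star), `KNGoodGC3.agood_threePort_ge` (eight-term expansion), `multiStar_row` (world
  form of the row over the |B| stars), `hairIneq_middle_multi` / `hairIneq_top_multi` + degeneracy bounds, `gc3_middle_arith` / `gc3_top_arith`;
  bottom case termwise.
[cite: KozmaNitzan2024, Thms. 4–5 (pp. 12–14), Lemma 5 (p. 13); VandenbergHaggstromKahn2005, Thm. 1.5 (p. 7)]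
-/

noncomputable section

namespace Summit.CriticalPhenomena.PercolationContinuityZ3.Theorems

open MeasureTheory Set Literature.Probability.LatticeModels Literature.Probability.Percolation
open scoped Classical BigOperators

variable {n : ℕ}

namespace KNGoodGC3Multi

open ChampionStability KNGoodAux KNGoodHair KNGoodSeries KNGoodPortFree KNGoodTwoTwo KNGoodGC3 KNSep

set_option maxHeartbeats 800000 in
/-- **GC₃ for any number of pendant-star children, forced-graph form, sorted labels, single row.**  See the module docstring.
`u = restrW {o}ᶜ w` is `G ∖ o`; the relays are labelled so that their reliabilities in the core `u` with `B` killed increase; the row is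
`μ_u(j b) ≤ μ_u(a₁ b)`. [cite: KozmaNitzan2024, Thms. 4–5 (pp. 12–14), Lemma 5 (p. 13); VandenbergHaggstromKahn2005, Thm. 1.5 (p. 7)] -/
theorem agood_forced_multi_sorted (w : Sym2 (Fin n) → unitInterval) (A : Finset (Fin n)) (hA : A.Nonempty)
    (o b a₁ a₂ a₃ j : Fin n) (hAeq : A = {a₁, a₂, a₃}) (h12 : a₁ ≠ a₂) (h13 : a₁ ≠ a₃) (h23 : a₂ ≠ a₃)
    (ho : o ∉ A) (hbo : b ≠ o) (hjA : j ∈ A)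
    (B : Finset (Fin n)) (hoB : o ∉ B)
    (hB : ∀ x ∈ B, x ∉ A ∧ b ≠ x ∧ ∀ z : Fin n, z ∉ A → z ≠ o → w s(x, z) = 0)
    (hs12 : (prodBernoulli (fun f : Sym2 (Fin n) => if (∃ v ∈ B, v ∈ f) then (0 : unitInterval) else restrW ({o}ᶜ : Set (Fin n)) w f)).real
        (openConn a₁ b) ≤
      (prodBernoulli (fun f : Sym2 (Fin n) => if (∃ v ∈ B, v ∈ f) then (0 : unitInterval) else restrW ({o}ᶜ : Set (Fin n)) w f)).real
        (openConn a₂ b))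
    (hs23 : (prodBernoulli (fun f : Sym2 (Fin n) => if (∃ v ∈ B, v ∈ f) then (0 : unitInterval) else restrW ({o}ᶜ : Set (Fin n)) w f)).real
        (openConn a₂ b) ≤
      (prodBernoulli (fun f : Sym2 (Fin n) => if (∃ v ∈ B, v ∈ f) then (0 : unitInterval) else restrW ({o}ᶜ : Set (Fin n)) w f)).real
        (openConn a₃ b))
    (hrow : (prodBernoulli (restrW ({o}ᶜ : Set (Fin n)) w)).real (openConn j b) ≤
      (prodBernoulli (restrW ({o}ᶜ : Set (Fin n)) w)).real (openConn a₁ b)) :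
    (prodBernoulli (fun e : Sym2 (Fin n) => if o ∈ e then (if ∃ p ∈ B, e = s(o, p) then 1 else 0) else w e)).real (openConn j b) ≤
      (prodBernoulli (fun e : Sym2 (Fin n) => if o ∈ e then (if ∃ p ∈ B, e = s(o, p) then 1 else 0) else w e)).real (openConn o b) +
        ∑ W ∈ nullSets A, (prodBernoulli (fun e : Sym2 (Fin n) => if o ∈ e then (if ∃ p ∈ B, e = s(o, p) then 1 else 0) else w e)).real
            (clusterIs o W) *
          A.inf' hA (fun a' => (prodBernoulli (fun e : Sym2 (Fin n) => if o ∈ e then (if ∃ p ∈ B, e = s(o, p) then 1 else 0) else w e)).real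
            (openConnIn ((↑W : Set (Fin n))ᶜ) a' b)) := by
  haveI : ∀ v : Sym2 (Fin n) → unitInterval, IsProbabilityMeasure (prodBernoulli v) := fun v => inferInstance
  haveI : ∀ v : Sym2 (Fin n) → unitInterval, IsProbabilityMeasure (prodBernoulli v) := fun v => inferInstance
  have ha₁ : a₁ ∈ A := by rw [hAeq]; simp
  have ha₂ : a₂ ∈ A := by rw [hAeq]; simp
  have ha₃ : a₃ ∈ A := by rw [hAeq]; simp
  have hoa₁ : o ≠ a₁ := fun h => ho (h ▸ ha₁)
  have hoa₂ : o ≠ a₂ := fun h => ho (h ▸ ha₂)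
  have hoa₃ : o ≠ a₃ := fun h => ho (h ▸ ha₃)
  have notA : ∀ z : Fin n, z ≠ a₁ → z ≠ a₂ → z ≠ a₃ → z ∉ A := by
    intro z h1 h2 h3; rw [hAeq]; simp [h1, h2, h3]
  have memA : ∀ z : Fin n, z ∈ A → z = a₁ ∨ z = a₂ ∨ z = a₃ := by
    intro z hz; rw [hAeq] at hz; simpa only [Finset.mem_insert, Finset.mem_singleton] using hz
  set WB : Sym2 (Fin n) → unitInterval := fun e => if o ∈ e then (if ∃ p ∈ B, e = s(o, p) then 1 else 0) else w e with hWB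
  set u : Sym2 (Fin n) → unitInterval := restrW ({o}ᶜ : Set (Fin n)) w with hu
  set KB : Sym2 (Fin n) → unitInterval := fun f => if (∃ v ∈ B, v ∈ f) then (0 : unitInterval) else u f with hKB
  have u_off : ∀ c d : Fin n, c ≠ o → d ≠ o → c ≠ d → u s(c, d) = w s(c, d) := by
    intro c d hc hd hcd
    exact restrW_apply_of_mem w (mk_mem_wireSet_iff.2 ⟨Set.mem_compl_singleton_iff.2 hc, Set.mem_compl_singleton_iff.2 hd, hcd⟩)
  have u_o : ∀ c : Fin n, u s(o, c) = 0 := fun c =>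
    restrW_apply_of_not_mem w (fun hm => (Set.mem_compl_singleton_iff.1 (mk_mem_wireSet_iff.1 hm).1) rfl)
  have u_diag : ∀ c : Fin n, u s(c, c) = 0 := fun c =>
    restrW_apply_of_not_mem w (fun hm => (mk_mem_wireSet_iff.1 hm).2.2 rfl)
  have hyo : ∀ y ∈ B, y ≠ o := fun y hy h => hoB (h ▸ hy)
  have hya : ∀ y ∈ B, y ≠ a₁ ∧ y ≠ a₂ ∧ y ≠ a₃ := by
    intro y hy
    exact ⟨fun h => (hB y hy).1 (h ▸ ha₁), fun h => (hB y hy).1 (h ▸ ha₂), fun h => (hB y hy).1 (h ▸ ha₃)⟩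
  -- the merged one-layer star
  obtain ⟨N, hag, hisoN, hloopN, hH₁, hH₂, hH₃, conv⟩ :=
    forcedMerge_exists w A hA o b a₁ a₂ a₃ j hAeq h12 h13 h23 ho hjA B hoB hB
  set K : Sym2 (Fin n) → unitInterval := fun e => if o ∈ e then 0 else N e with hK
  have h8 := agood_threePort_ge N A hA o b a₁ a₂ a₃ j h12 h13 h23 ho ha₁ ha₂ ha₃ hjA hbo hisoN hloopN K hK
  have conv0 : ∀ z : Fin n, (prodBernoulli K).real (openConn z b) = (prodBernoulli KB).real (openConn z b) := by
    intro z
    have h := conv ∅ z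
    simpa only [Finset.notMem_empty, if_false] using h
  -- bounds on the hairs
  have hu01 : ∀ (a y : Fin n), 0 ≤ (u s(y, a) : ℝ) ∧ (u s(y, a) : ℝ) ≤ 1 := fun a y => ⟨(u s(y, a)).2.1, (u s(y, a)).2.2⟩
  have b₁ : ∀ y ∈ B, 0 ≤ (u s(y, a₁) : ℝ) ∧ (u s(y, a₁) : ℝ) ≤ 1 := fun y _ => hu01 a₁ y
  have b₂ : ∀ y ∈ B, 0 ≤ (u s(y, a₂) : ℝ) ∧ (u s(y, a₂) : ℝ) ≤ 1 := fun y _ => hu01 a₂ y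
  have b₃ : ∀ y ∈ B, 0 ≤ (u s(y, a₃) : ℝ) ∧ (u s(y, a₃) : ℝ) ≤ 1 := fun y _ => hu01 a₃ y
  have hP₁b := prod_mem_unit B (fun y => 1 - (u s(y, a₁) : ℝ)) (fun y hy => by linarith [(b₁ y hy).2])
    (fun y hy => by linarith [(b₁ y hy).1])
  have hP₂b := prod_mem_unit B (fun y => 1 - (u s(y, a₂) : ℝ)) (fun y hy => by linarith [(b₂ y hy).2])
    (fun y hy => by linarith [(b₂ y hy).1])
  have hP₃b := prod_mem_unit B (fun y => 1 - (u s(y, a₃) : ℝ)) (fun y hy => by linarith [(b₃ y hy).2])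
    (fun y hy => by linarith [(b₃ y hy).1])
  -- hair inequalities and degeneracy bounds for the family `B`
  have hair2 := hairIneq_middle_multi B (fun y => (u s(y, a₁) : ℝ)) (fun y => (u s(y, a₂) : ℝ)) (fun y => (u s(y, a₃) : ℝ)) b₁ b₂ b₃
  have hair3 := hairIneq_top_multi B (fun y => (u s(y, a₁) : ℝ)) (fun y => (u s(y, a₂) : ℝ)) (fun y => (u s(y, a₃) : ℝ)) b₁ b₂ b₃
  have deg2 := noHit23_le_qd_multi B (fun y => (u s(y, a₁) : ℝ)) (fun y => (u s(y, a₂) : ℝ)) (fun y => (u s(y, a₃) : ℝ)) b₁ b₂ b₃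
  have deg3 := noHit3_le_qd_add_q12_multi B (fun y => (u s(y, a₁) : ℝ)) (fun y => (u s(y, a₂) : ℝ)) (fun y => (u s(y, a₃) : ℝ)) b₁ b₂ b₃
  beta_reduce at hair2 hair3 deg2 deg3 hP₁b hP₂b hP₃b
  -- nonnegativity of the world weights
  have hα0 : ∀ y ∈ B, 0 ≤ (1 - (u s(y, a₁) : ℝ)) * (1 - (u s(y, a₂) : ℝ)) * (1 - (u s(y, a₃) : ℝ)) +
      (u s(y, a₁) : ℝ) * (1 - (u s(y, a₂) : ℝ)) * (1 - (u s(y, a₃) : ℝ)) + (1 - (u s(y, a₁) : ℝ)) * (u s(y, a₂) : ℝ) * (1 - (u s(y, a₃) : ℝ)) +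
      (1 - (u s(y, a₁) : ℝ)) * (1 - (u s(y, a₂) : ℝ)) * (u s(y, a₃) : ℝ) :=
    fun y hy => alpha_nonneg (b₁ y hy).1 (b₁ y hy).2 (b₂ y hy).1 (b₂ y hy).2 (b₃ y hy).1 (b₃ y hy).2
  have hQD0 : 0 ≤ ∏ y ∈ B, ((1 - (u s(y, a₁) : ℝ)) * (1 - (u s(y, a₂) : ℝ)) * (1 - (u s(y, a₃) : ℝ)) +
      (u s(y, a₁) : ℝ) * (1 - (u s(y, a₂) : ℝ)) * (1 - (u s(y, a₃) : ℝ)) + (1 - (u s(y, a₁) : ℝ)) * (u s(y, a₂) : ℝ) * (1 - (u s(y, a₃) : ℝ)) +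
      (1 - (u s(y, a₁) : ℝ)) * (1 - (u s(y, a₂) : ℝ)) * (u s(y, a₃) : ℝ)) := Finset.prod_nonneg hα0
  have hE13D : ∏ y ∈ B, ((1 - (u s(y, a₁) : ℝ)) * (1 - (u s(y, a₂) : ℝ)) * (1 - (u s(y, a₃) : ℝ)) +
      (u s(y, a₁) : ℝ) * (1 - (u s(y, a₂) : ℝ)) * (1 - (u s(y, a₃) : ℝ)) + (1 - (u s(y, a₁) : ℝ)) * (u s(y, a₂) : ℝ) * (1 - (u s(y, a₃) : ℝ)) +
      (1 - (u s(y, a₁) : ℝ)) * (1 - (u s(y, a₂) : ℝ)) * (u s(y, a₃) : ℝ)) ≤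
      ∏ y ∈ B, ((1 - (u s(y, a₁) : ℝ)) * (1 - (u s(y, a₂) : ℝ)) * (1 - (u s(y, a₃) : ℝ)) +
      (u s(y, a₁) : ℝ) * (1 - (u s(y, a₂) : ℝ)) * (1 - (u s(y, a₃) : ℝ)) + (1 - (u s(y, a₁) : ℝ)) * (u s(y, a₂) : ℝ) * (1 - (u s(y, a₃) : ℝ)) +
      (1 - (u s(y, a₁) : ℝ)) * (1 - (u s(y, a₂) : ℝ)) * (u s(y, a₃) : ℝ) + (u s(y, a₁) : ℝ) * (1 - (u s(y, a₂) : ℝ)) * (u s(y, a₃) : ℝ)) :=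
    Finset.prod_le_prod hα0 fun y hy => by
      have : 0 ≤ (u s(y, a₁) : ℝ) * (1 - (u s(y, a₂) : ℝ)) * (u s(y, a₃) : ℝ) :=
        mul_nonneg (mul_nonneg (b₁ y hy).1 (by linarith [(b₂ y hy).2])) (b₃ y hy).1
      linarith
  have hE23D : ∏ y ∈ B, ((1 - (u s(y, a₁) : ℝ)) * (1 - (u s(y, a₂) : ℝ)) * (1 - (u s(y, a₃) : ℝ)) +
      (u s(y, a₁) : ℝ) * (1 - (u s(y, a₂) : ℝ)) * (1 - (u s(y, a₃) : ℝ)) + (1 - (u s(y, a₁) : ℝ)) * (u s(y, a₂) : ℝ) * (1 - (u s(y, a₃) : ℝ)) +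
      (1 - (u s(y, a₁) : ℝ)) * (1 - (u s(y, a₂) : ℝ)) * (u s(y, a₃) : ℝ)) ≤
      ∏ y ∈ B, ((1 - (u s(y, a₁) : ℝ)) * (1 - (u s(y, a₂) : ℝ)) * (1 - (u s(y, a₃) : ℝ)) +
      (u s(y, a₁) : ℝ) * (1 - (u s(y, a₂) : ℝ)) * (1 - (u s(y, a₃) : ℝ)) + (1 - (u s(y, a₁) : ℝ)) * (u s(y, a₂) : ℝ) * (1 - (u s(y, a₃) : ℝ)) +
      (1 - (u s(y, a₁) : ℝ)) * (1 - (u s(y, a₂) : ℝ)) * (u s(y, a₃) : ℝ) + (1 - (u s(y, a₁) : ℝ)) * (u s(y, a₂) : ℝ) * (u s(y, a₃) : ℝ)) :=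
    Finset.prod_le_prod hα0 fun y hy => by
      have : 0 ≤ (1 - (u s(y, a₁) : ℝ)) * (u s(y, a₂) : ℝ) * (u s(y, a₃) : ℝ) :=
        mul_nonneg (mul_nonneg (by linarith [(b₁ y hy).2]) (b₂ y hy).1) (b₃ y hy).1
      linarith
  have hE12D : ∏ y ∈ B, ((1 - (u s(y, a₁) : ℝ)) * (1 - (u s(y, a₂) : ℝ)) * (1 - (u s(y, a₃) : ℝ)) +
      (u s(y, a₁) : ℝ) * (1 - (u s(y, a₂) : ℝ)) * (1 - (u s(y, a₃) : ℝ)) + (1 - (u s(y, a₁) : ℝ)) * (u s(y, a₂) : ℝ) * (1 - (u s(y, a₃) : ℝ)) +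
      (1 - (u s(y, a₁) : ℝ)) * (1 - (u s(y, a₂) : ℝ)) * (u s(y, a₃) : ℝ)) ≤
      ∏ y ∈ B, ((1 - (u s(y, a₁) : ℝ)) * (1 - (u s(y, a₂) : ℝ)) * (1 - (u s(y, a₃) : ℝ)) +
      (u s(y, a₁) : ℝ) * (1 - (u s(y, a₂) : ℝ)) * (1 - (u s(y, a₃) : ℝ)) + (1 - (u s(y, a₁) : ℝ)) * (u s(y, a₂) : ℝ) * (1 - (u s(y, a₃) : ℝ)) +
      (1 - (u s(y, a₁) : ℝ)) * (1 - (u s(y, a₂) : ℝ)) * (u s(y, a₃) : ℝ) + (u s(y, a₁) : ℝ) * (u s(y, a₂) : ℝ) * (1 - (u s(y, a₃) : ℝ))) :=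
    Finset.prod_le_prod hα0 fun y hy => by
      have : 0 ≤ (u s(y, a₁) : ℝ) * (u s(y, a₂) : ℝ) * (1 - (u s(y, a₃) : ℝ)) :=
        mul_nonneg (mul_nonneg (b₁ y hy).1 (b₂ y hy).1) (by linarith [(b₃ y hy).2])
      linarith
  -- the stars of `B` are pendant stars of `u`
  have hxs : ∀ x ∈ B.toList, x ≠ a₁ ∧ x ≠ a₂ ∧ x ≠ a₃ ∧ b ≠ x ∧ ∀ v : Fin n, v ∉ ({a₁, a₂, a₃} : Finset (Fin n)) → u s(x, v) = 0 := by
    intro x hx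
    rw [Finset.mem_toList] at hx
    refine ⟨(hya x hx).1, (hya x hx).2.1, (hya x hx).2.2, (hB x hx).2.1, fun v hv => ?_⟩
    simp only [Finset.mem_insert, Finset.mem_singleton, not_or] at hv
    by_cases hvo : v = o
    · rw [hvo, Sym2.eq_swap]; exact u_o x
    by_cases hvx : v = x
    · rw [hvx]; exact u_diag x
    rw [u_off x v (hyo x hx) hvo (fun h => hvx h.symm)]
    exact (hB x hx).2.2 v (notA v hv.1 hv.2.1 hv.2.2) hvo
  -- world expansions of the two rows (middle: `a₁` vs `a₂`; top: `a₁` vs `a₃`)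
  have R12 := multiStar_row u b a₁ a₂ a₃ h12 h13 h23 B.toList (Finset.nodup_toList B) hxs ∅ (by simp) ∅ (by simp)
    (Finset.notMem_empty _) (Finset.notMem_empty _) (Finset.notMem_empty _)
  have hxs' : ∀ x ∈ B.toList, x ≠ a₁ ∧ x ≠ a₃ ∧ x ≠ a₂ ∧ b ≠ x ∧ ∀ v : Fin n, v ∉ ({a₁, a₃, a₂} : Finset (Fin n)) → u s(x, v) = 0 := by
    intro x hx
    obtain ⟨h1, h2, h3, h4, h5⟩ := hxs x hx
    refine ⟨h1, h3, h2, h4, fun v hv => h5 v ?_⟩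
    simp only [Finset.mem_insert, Finset.mem_singleton, not_or] at hv ⊢
    exact ⟨hv.1, hv.2.2, hv.2.1⟩
  have R13 := multiStar_row u b a₁ a₃ a₂ h13 h12 (fun h => h23 h.symm) B.toList (Finset.nodup_toList B) hxs' ∅ (by simp) ∅ (by simp)
    (Finset.notMem_empty _) (Finset.notMem_empty _) (Finset.notMem_empty _)
  simp only [Finset.notMem_empty, if_false, false_and, exists_false, Finset.empty_union, Finset.toList_toFinset,
    Finset.prod_map_toList] at R12 R13
  -- the swapped-label products of the top row
  have eQD : ∏ x ∈ B, ((1 - (u s(x, a₁) : ℝ)) * (1 - (u s(x, a₃) : ℝ)) * (1 - (u s(x, a₂) : ℝ)) +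
      (u s(x, a₁) : ℝ) * (1 - (u s(x, a₃) : ℝ)) * (1 - (u s(x, a₂) : ℝ)) + (1 - (u s(x, a₁) : ℝ)) * (u s(x, a₃) : ℝ) * (1 - (u s(x, a₂) : ℝ)) +
      (1 - (u s(x, a₁) : ℝ)) * (1 - (u s(x, a₃) : ℝ)) * (u s(x, a₂) : ℝ)) =
      ∏ y ∈ B, ((1 - (u s(y, a₁) : ℝ)) * (1 - (u s(y, a₂) : ℝ)) * (1 - (u s(y, a₃) : ℝ)) +
      (u s(y, a₁) : ℝ) * (1 - (u s(y, a₂) : ℝ)) * (1 - (u s(y, a₃) : ℝ)) + (1 - (u s(y, a₁) : ℝ)) * (u s(y, a₂) : ℝ) * (1 - (u s(y, a₃) : ℝ)) +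
      (1 - (u s(y, a₁) : ℝ)) * (1 - (u s(y, a₂) : ℝ)) * (u s(y, a₃) : ℝ)) := Finset.prod_congr rfl fun y _ => by ring
  have eE12 : ∏ x ∈ B, ((1 - (u s(x, a₁) : ℝ)) * (1 - (u s(x, a₃) : ℝ)) * (1 - (u s(x, a₂) : ℝ)) +
      (u s(x, a₁) : ℝ) * (1 - (u s(x, a₃) : ℝ)) * (1 - (u s(x, a₂) : ℝ)) + (1 - (u s(x, a₁) : ℝ)) * (u s(x, a₃) : ℝ) * (1 - (u s(x, a₂) : ℝ)) +
      (1 - (u s(x, a₁) : ℝ)) * (1 - (u s(x, a₃) : ℝ)) * (u s(x, a₂) : ℝ) + (u s(x, a₁) : ℝ) * (1 - (u s(x, a₃) : ℝ)) * (u s(x, a₂) : ℝ)) =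
      ∏ y ∈ B, ((1 - (u s(y, a₁) : ℝ)) * (1 - (u s(y, a₂) : ℝ)) * (1 - (u s(y, a₃) : ℝ)) +
      (u s(y, a₁) : ℝ) * (1 - (u s(y, a₂) : ℝ)) * (1 - (u s(y, a₃) : ℝ)) + (1 - (u s(y, a₁) : ℝ)) * (u s(y, a₂) : ℝ) * (1 - (u s(y, a₃) : ℝ)) +
      (1 - (u s(y, a₁) : ℝ)) * (1 - (u s(y, a₂) : ℝ)) * (u s(y, a₃) : ℝ) + (u s(y, a₁) : ℝ) * (u s(y, a₂) : ℝ) * (1 - (u s(y, a₃) : ℝ))) :=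
    Finset.prod_congr rfl fun y _ => by ring
  have eE23 : ∏ x ∈ B, ((1 - (u s(x, a₁) : ℝ)) * (1 - (u s(x, a₃) : ℝ)) * (1 - (u s(x, a₂) : ℝ)) +
      (u s(x, a₁) : ℝ) * (1 - (u s(x, a₃) : ℝ)) * (1 - (u s(x, a₂) : ℝ)) + (1 - (u s(x, a₁) : ℝ)) * (u s(x, a₃) : ℝ) * (1 - (u s(x, a₂) : ℝ)) +
      (1 - (u s(x, a₁) : ℝ)) * (1 - (u s(x, a₃) : ℝ)) * (u s(x, a₂) : ℝ) + (1 - (u s(x, a₁) : ℝ)) * (u s(x, a₃) : ℝ) * (u s(x, a₂) : ℝ)) =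
      ∏ y ∈ B, ((1 - (u s(y, a₁) : ℝ)) * (1 - (u s(y, a₂) : ℝ)) * (1 - (u s(y, a₃) : ℝ)) +
      (u s(y, a₁) : ℝ) * (1 - (u s(y, a₂) : ℝ)) * (1 - (u s(y, a₃) : ℝ)) + (1 - (u s(y, a₁) : ℝ)) * (u s(y, a₂) : ℝ) * (1 - (u s(y, a₃) : ℝ)) +
      (1 - (u s(y, a₁) : ℝ)) * (1 - (u s(y, a₂) : ℝ)) * (u s(y, a₃) : ℝ) + (1 - (u s(y, a₁) : ℝ)) * (u s(y, a₂) : ℝ) * (u s(y, a₃) : ℝ)) :=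
    Finset.prod_congr rfl fun y _ => by ring
  have hsw : ({s(a₃, a₂)} : Finset (Sym2 (Fin n))) = {s(a₂, a₃)} := by rw [Sym2.eq_swap]
  rw [eQD, eE12, eE23, hsw] at R13
  -- name the products
  set P₁ := ∏ y ∈ B, (1 - (u s(y, a₁) : ℝ)) with hP₁
  set P₂ := ∏ y ∈ B, (1 - (u s(y, a₂) : ℝ)) with hP₂
  set P₃ := ∏ y ∈ B, (1 - (u s(y, a₃) : ℝ)) with hP₃
  set QD := ∏ y ∈ B, ((1 - (u s(y, a₁) : ℝ)) * (1 - (u s(y, a₂) : ℝ)) * (1 - (u s(y, a₃) : ℝ)) +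
      (u s(y, a₁) : ℝ) * (1 - (u s(y, a₂) : ℝ)) * (1 - (u s(y, a₃) : ℝ)) + (1 - (u s(y, a₁) : ℝ)) * (u s(y, a₂) : ℝ) * (1 - (u s(y, a₃) : ℝ)) +
      (1 - (u s(y, a₁) : ℝ)) * (1 - (u s(y, a₂) : ℝ)) * (u s(y, a₃) : ℝ)) with hQD
  set E13 := ∏ y ∈ B, ((1 - (u s(y, a₁) : ℝ)) * (1 - (u s(y, a₂) : ℝ)) * (1 - (u s(y, a₃) : ℝ)) +
      (u s(y, a₁) : ℝ) * (1 - (u s(y, a₂) : ℝ)) * (1 - (u s(y, a₃) : ℝ)) + (1 - (u s(y, a₁) : ℝ)) * (u s(y, a₂) : ℝ) * (1 - (u s(y, a₃) : ℝ)) +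
      (1 - (u s(y, a₁) : ℝ)) * (1 - (u s(y, a₂) : ℝ)) * (u s(y, a₃) : ℝ) + (u s(y, a₁) : ℝ) * (1 - (u s(y, a₂) : ℝ)) * (u s(y, a₃) : ℝ)) with hE13
  set E23 := ∏ y ∈ B, ((1 - (u s(y, a₁) : ℝ)) * (1 - (u s(y, a₂) : ℝ)) * (1 - (u s(y, a₃) : ℝ)) +
      (u s(y, a₁) : ℝ) * (1 - (u s(y, a₂) : ℝ)) * (1 - (u s(y, a₃) : ℝ)) + (1 - (u s(y, a₁) : ℝ)) * (u s(y, a₂) : ℝ) * (1 - (u s(y, a₃) : ℝ)) +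
      (1 - (u s(y, a₁) : ℝ)) * (1 - (u s(y, a₂) : ℝ)) * (u s(y, a₃) : ℝ) + (1 - (u s(y, a₁) : ℝ)) * (u s(y, a₂) : ℝ) * (u s(y, a₃) : ℝ)) with hE23
  set E12 := ∏ y ∈ B, ((1 - (u s(y, a₁) : ℝ)) * (1 - (u s(y, a₂) : ℝ)) * (1 - (u s(y, a₃) : ℝ)) +
      (u s(y, a₁) : ℝ) * (1 - (u s(y, a₂) : ℝ)) * (1 - (u s(y, a₃) : ℝ)) + (1 - (u s(y, a₁) : ℝ)) * (u s(y, a₂) : ℝ) * (1 - (u s(y, a₃) : ℝ)) +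
      (1 - (u s(y, a₁) : ℝ)) * (1 - (u s(y, a₂) : ℝ)) * (u s(y, a₃) : ℝ) + (u s(y, a₁) : ℝ) * (u s(y, a₂) : ℝ) * (1 - (u s(y, a₃) : ℝ))) with hE12
  obtain ⟨hP₁0, hP₁1⟩ := hP₁b
  obtain ⟨hP₂0, hP₂1⟩ := hP₂b
  obtain ⟨hP₃0, hP₃1⟩ := hP₃b
  -- abbreviations for the core reliabilities (KB-forms)
  set s₁ := (prodBernoulli KB).real (openConn a₁ b) with hs₁
  set s₂ := (prodBernoulli KB).real (openConn a₂ b) with hs₂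
  set s₃ := (prodBernoulli KB).real (openConn a₃ b) with hs₃
  -- the minimum over `A` in the core is `s₁`
  have hinf : A.inf' hA (fun a => (prodBernoulli K).real (openConn a b)) = s₁ := by
    refine le_antisymm ((Finset.inf'_le _ ha₁).trans (le_of_eq (conv0 a₁))) ?_
    refine Finset.le_inf' hA _ fun a ha => ?_
    rw [conv0 a]
    rcases memA a ha with rfl | rfl | rfl
    · exact le_rfl
    · exact hs12
    · exact hs12.trans hs23
  rw [hinf] at h8
  -- convert every `K`-form of `h8` into the `KB`-form
  rw [conv0, conv0, conv0, conv0, conv, conv, conv, conv, conv, conv, conv, conv] at h8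
  rw [hH₁, hH₂, hH₃] at h8
  set K12 : Sym2 (Fin n) → unitInterval := fun f => if f ∈ ({s(a₁, a₂)} : Finset (Sym2 (Fin n))) then 1 else KB f with hK12
  set K13 : Sym2 (Fin n) → unitInterval := fun f => if f ∈ ({s(a₁, a₃)} : Finset (Sym2 (Fin n))) then 1 else KB f with hK13
  set K23 : Sym2 (Fin n) → unitInterval := fun f => if f ∈ ({s(a₂, a₃)} : Finset (Sym2 (Fin n))) then 1 else KB f with hK23
  set K123 : Sym2 (Fin n) → unitInterval :=
    fun f => if f ∈ ({s(a₁, a₂), s(a₁, a₃)} : Finset (Sym2 (Fin n))) then 1 else KB f with hK123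
  -- ties inside the glued cores
  have t12 : (prodBernoulli K12).real (openConn a₁ b) = (prodBernoulli K12).real (openConn a₂ b) := tie_of_mem KB _ h12 (by simp) b
  have t13 : (prodBernoulli K13).real (openConn a₁ b) = (prodBernoulli K13).real (openConn a₃ b) := tie_of_mem KB _ h13 (by simp) b
  have t23 : (prodBernoulli K23).real (openConn a₂ b) = (prodBernoulli K23).real (openConn a₃ b) := tie_of_mem KB _ h23 (by simp) b
  have t123a : (prodBernoulli K123).real (openConn a₁ b) = (prodBernoulli K123).real (openConn a₂ b) := tie_of_mem KB _ h12 (by simp) b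
  have t123b : (prodBernoulli K123).real (openConn a₁ b) = (prodBernoulli K123).real (openConn a₃ b) := tie_of_mem KB _ h13 (by simp) b
  -- exchange rows in the core `KB`
  have updF : ∀ c d : Fin n, Function.update KB s(c, d) 1 =
      fun f => if f ∈ ({s(c, d)} : Finset (Sym2 (Fin n))) then 1 else KB f := by
    intro c d; funext f; simp only [Function.update_apply, Finset.mem_singleton]
  have E1 : (prodBernoulli K23).real (openConn a₁ b) ≤ (prodBernoulli K23).real (openConn a₂ b) := by
    have h := glueTransfer_openConn KB a₂ a₃ a₁ b h23 (hs12.trans hs23)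
    rwa [updF] at h
  have E2 : (prodBernoulli K13).real (openConn a₂ b) ≤ (prodBernoulli K13).real (openConn a₁ b) := by
    have h := glueTransfer_openConn KB a₁ a₃ a₂ b h13 hs23
    rwa [updF] at h
  have Etie : s₃ ≤ s₁ → (prodBernoulli K12).real (openConn a₃ b) ≤ (prodBernoulli K12).real (openConn a₁ b) := by
    intro h
    have h' := glueTransfer_openConn KB a₂ a₁ a₃ b (fun e => h12 e.symm) h
    rw [updF] at h'
    have hsw' : ({s(a₂, a₁)} : Finset (Sym2 (Fin n))) = {s(a₁, a₂)} := by rw [Sym2.eq_swap]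
    rw [hsw'] at h'
    rw [t12]; exact h'
  -- the goal is `0 ≤ agood(WB, o; j) = agood(N, o; j) ≥ LB`
  rw [← sub_nonneg]
  have hgoal : (prodBernoulli WB).real (openConn o b) +
        ∑ W ∈ nullSets A, (prodBernoulli WB).real (clusterIs o W) *
          A.inf' hA (fun a' => (prodBernoulli WB).real (openConnIn ((↑W : Set (Fin n))ᶜ) a' b)) -
        (prodBernoulli WB).real (openConn j b) =
      (prodBernoulli N).real (openConn o b) - (prodBernoulli N).real (openConn j b) +
        ∑ W ∈ nullSets A, (prodBernoulli N).real (clusterIs o W) *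
          A.inf' hA (fun a' => (prodBernoulli N).real (openConnIn ((↑W : Set (Fin n))ᶜ) a' b)) := by
    rw [← hag]; ring
  rw [hgoal]
  refine le_trans ?_ h8
  have hj : j = a₁ ∨ j = a₂ ∨ j = a₃ := memA j hjA
  have hrow' : (prodBernoulli u).real (openConn j b) ≤ (prodBernoulli u).real (openConn a₁ b) := hrow
  rcases hj with hj | hj | hj
  · -- bottom case: every pattern term is non-negative
    rw [hj, ← hs₁]
    have c2 : 0 ≤ (1 - (1 - P₁)) * (1 - P₂) * (1 - (1 - P₃)) := mul_nonneg (mul_nonneg (by linarith) (by linarith)) (by linarith)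
    have c3 : 0 ≤ (1 - (1 - P₁)) * (1 - (1 - P₂)) * (1 - P₃) := mul_nonneg (mul_nonneg (by linarith) (by linarith)) (by linarith)
    have c23 : 0 ≤ (1 - (1 - P₁)) * (1 - P₂) * (1 - P₃) := mul_nonneg (mul_nonneg (by linarith) (by linarith)) (by linarith)
    have hV2 : 0 ≤ s₂ - s₁ := sub_nonneg.2 hs12
    have hV3 : 0 ≤ s₃ - s₁ := sub_nonneg.2 (hs12.trans hs23)
    have hV23 : 0 ≤ (prodBernoulli K23).real (openConn a₂ b) - (prodBernoulli K23).real (openConn a₁ b) := sub_nonneg.2 E1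
    linarith [mul_nonneg c2 hV2, mul_nonneg c3 hV3, mul_nonneg c23 hV23]
  · -- middle case
    rw [hj] at hrow' ⊢
    have hyp : QD * (s₂ - s₁) + (E23 - QD) * ((prodBernoulli K23).real (openConn a₂ b) - (prodBernoulli K23).real (openConn a₁ b)) ≤
        (E13 - QD) * ((prodBernoulli K13).real (openConn a₁ b) - (prodBernoulli K13).real (openConn a₂ b)) := by
      have h0 : 0 ≤ (prodBernoulli u).real (openConn a₁ b) - (prodBernoulli u).real (openConn a₂ b) := sub_nonneg.2 hrow'
      rw [R12] at h0
      linarith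
    have hair2' : (1 - (1 - P₃)) * (E13 - QD) ≤ (1 - P₁) * (1 - P₃) * QD := by
      have e : (1 - (1 - P₃)) * (E13 - QD) = P₃ * (E13 - QD) := by ring
      rw [e]; exact hair2
    have deg2' : (1 - (1 - P₂)) * (1 - (1 - P₃)) ≤ QD := by
      have e : (1 - (1 - P₂)) * (1 - (1 - P₃)) = P₂ * P₃ := by ring
      rw [e]; exact deg2
    have core := gc3_middle_arith (H₁ := 1 - P₁) (H₂ := 1 - P₂) (H₃ := 1 - P₃) (by linarith) (by linarith) (by linarith) (by linarith)
      (by linarith) hQD0 (sub_nonneg.2 hE13D) (sub_nonneg.2 hE23D) (sub_nonneg.2 hs12) (sub_nonneg.2 hs23) (sub_nonneg.2 E2)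
      (sub_nonneg.2 E1) hyp hair2' deg2'
    rw [← hs₂, ← t12, ← t123a]
    have e : (1 - (1 - P₁)) * (1 - (1 - P₂)) * (1 - (1 - P₃)) * (s₁ - s₂) +
        (1 - P₁) * (1 - (1 - P₂)) * (1 - (1 - P₃)) * (s₁ - s₂) +
        (1 - (1 - P₁)) * (1 - P₂) * (1 - (1 - P₃)) * (s₂ - s₂) +
        (1 - (1 - P₁)) * (1 - (1 - P₂)) * (1 - P₃) * (s₃ - s₂) +
        (1 - P₁) * (1 - P₂) * (1 - (1 - P₃)) *
          ((prodBernoulli K12).real (openConn a₁ b) - (prodBernoulli K12).real (openConn a₁ b)) +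
        (1 - P₁) * (1 - (1 - P₂)) * (1 - P₃) *
          ((prodBernoulli K13).real (openConn a₁ b) - (prodBernoulli K13).real (openConn a₂ b)) +
        (1 - (1 - P₁)) * (1 - P₂) * (1 - P₃) *
          ((prodBernoulli K23).real (openConn a₂ b) - (prodBernoulli K23).real (openConn a₂ b)) +
        (1 - P₁) * (1 - P₂) * (1 - P₃) *
          ((prodBernoulli K123).real (openConn a₁ b) - (prodBernoulli K123).real (openConn a₁ b)) =
      (1 - (1 - P₂)) * (-((1 - (1 - P₃)) * (s₂ - s₁)) +
        (1 - P₃) * (1 - (1 - P₁)) * (s₃ - s₂) + (1 - P₁) * (1 - P₃) *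
          ((prodBernoulli K13).real (openConn a₁ b) - (prodBernoulli K13).real (openConn a₂ b))) := by
      ring
    linarith [core, e]
  · -- top case
    rw [hj] at hrow' ⊢
    have hyp : QD * (s₃ - s₁) + (E23 - QD) * ((prodBernoulli K23).real (openConn a₂ b) - (prodBernoulli K23).real (openConn a₁ b)) ≤
        (E12 - QD) * ((prodBernoulli K12).real (openConn a₁ b) - (prodBernoulli K12).real (openConn a₃ b)) := by
      have h0 : 0 ≤ (prodBernoulli u).real (openConn a₁ b) - (prodBernoulli u).real (openConn a₃ b) := sub_nonneg.2 hrow'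
      rw [R13, ← t23] at h0
      linarith
    have deg3' : 1 - (1 - P₃) ≤ QD + (E12 - QD) := by
      have e : 1 - (1 - P₃) = P₃ := by ring
      rw [e]; linarith [deg3]
    have core := gc3_top_arith (H₁ := 1 - P₁) (H₂ := 1 - P₂) (H₃ := 1 - P₃) (by linarith) (by linarith) (by linarith) (by linarith)
      (by linarith) hQD0 (sub_nonneg.2 hE12D) (sub_nonneg.2 hE23D) (sub_nonneg.2 (hs12.trans hs23)) (sub_nonneg.2 hs23)
      (by linarith) (sub_nonneg.2 E1) hyp hair3 deg3' (fun h0 => by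
          have hs31 : s₃ ≤ s₁ := by linarith
          linarith [Etie hs31])
    rw [← hs₃, ← t13, ← t23, ← t123b]
    have e : (1 - (1 - P₁)) * (1 - (1 - P₂)) * (1 - (1 - P₃)) * (s₁ - s₃) +
        (1 - P₁) * (1 - (1 - P₂)) * (1 - (1 - P₃)) * (s₁ - s₃) +
        (1 - (1 - P₁)) * (1 - P₂) * (1 - (1 - P₃)) * (s₂ - s₃) +
        (1 - (1 - P₁)) * (1 - (1 - P₂)) * (1 - P₃) * (s₃ - s₃) +
        (1 - P₁) * (1 - P₂) * (1 - (1 - P₃)) *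
          ((prodBernoulli K12).real (openConn a₁ b) - (prodBernoulli K12).real (openConn a₃ b)) +
        (1 - P₁) * (1 - (1 - P₂)) * (1 - P₃) *
          ((prodBernoulli K13).real (openConn a₁ b) - (prodBernoulli K13).real (openConn a₁ b)) +
        (1 - (1 - P₁)) * (1 - P₂) * (1 - P₃) *
          ((prodBernoulli K23).real (openConn a₂ b) - (prodBernoulli K23).real (openConn a₂ b)) +
        (1 - P₁) * (1 - P₂) * (1 - P₃) *
          ((prodBernoulli K123).real (openConn a₁ b) - (prodBernoulli K123).real (openConn a₁ b)) =
      (1 - (1 - P₃)) * (-((1 - (1 - P₂)) * (s₃ - s₁)) - (1 - P₂) * (1 - (1 - P₁)) * (s₃ - s₂) +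
        (1 - P₁) * (1 - P₂) * ((prodBernoulli K12).real (openConn a₁ b) - (prodBernoulli K12).real (openConn a₃ b))) := by
      ring
    linarith [core, e]

end KNGoodGC3Multi

end Summit.CriticalPhenomena.PercolationContinuityZ3.Theorems
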